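import Summits.BirchSwinnertonDyer.BirchSwinnertonDyer.Theorems.KimAtThreeAnomalousTorsion
import Literature.NumberTheory.AdelicBaseChange.CompletionBaseChange
import Mathlib.FieldTheory.Galois.Basic
import HarnessLib

/-!
# The fixed field of the local Frobenius `σ_w` is `ℚ_v`; the anomalous-row lattice lemma assembled

Helper for the W2 crux `KimAtThreeKolyvagin.DeepLowerAtThreeOffKatoStratum` (good-ANOMALOUS rows of
`stub_additiveDefect`, support statement `FineKatoTauAnomalousThree`).  Last local input of the
E-side lattice lemma: the fixed-field hypothesis `hfix` of `KimAtThreeAnomalousTorsion`.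

* `mem_range_algebraMap_of_galAdicCompletionMap_eq` — for `σ ∈ Aut(L/ℚ)` with `σ • w = w` and
  `ord σ = [L_w : ℚ_v]`, every `z ∈ L_w` with `σ_w z = z` lies in (the image of) `ℚ_v`.  Artin's
  theorem (Mathlib `IntermediateField.finrank_fixedField_eq_card`) for `H = ⟨σ_w⟩ ≤ Aut(L_w/ℚ_v)`:
  `[L_w : L_w^H] = #H = ord σ_w = ord σ = [L_w : ℚ_v]`, so `L_w^H = ℚ_v`; `σ_w` is `ℚ_v`-linear by the
  packet's `galAdicCompletionMap_algebraMap_adicCompletion`, and `ord σ_w = ord σ` because `L ↪ L_w`.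
  `…_of_unramified`: with `e(w∣p) = 1` the hypothesis reads `ord σ = f(w∣p)`.
* `forall_prime_nsmul_eq_zero_of_frobenius` — **`E(L_w)[p] = 0` on a good-anomalous row from
  `E(ℚ_v)[p] = 0`** (`p ≥ 3`, `p ∤ Δ_min`, `a_p ≡ 1 (mod p)`, `e(w∣p) = 1`, `σ` the Frobenius of `w`).
* `exists_padicLog_eq_iff_of_frobenius_anomalous` — **the lattice lemma
  `log_ω E(L_w) = E_p(σ_w)⁻¹𝒪_w` on a good-anomalous row with every local hypothesis discharged**
  (remaining inputs, all global: `p ∤ Δ_min(W)`, `a_p ≡ 1 (mod p)`, `E(ℚ_v)[p] = 0`, and the Frobenius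
  `σ` of `w`: `σ • w = w`, `σ • a ≡ a^p (mod 𝔭_w)`, `ord σ = f(w∣p)`).
* `forall_nsmul_eq_zero_of_natCard_eq_one` — the item's spelling `Nat.card {Q // p • Q = 0} = 1`.

References: Cassels–Fröhlich (1967) Ch. VII §1.1; Silverman, AEC (2009) VII.3.1, IV.6.1;
Bloch–Kato (1990) Example 3.11.
-/

noncomputable section

-- the cell's Theorems namespace repeats the summit name by design (D-0017)
set_option linter.dupNamespace false

open scoped Classical NNReal NumberField
open IsDedekindDomain NumberField
open Literature.NumberTheory.Automorphic Literature.NumberTheory.AdelicBaseChange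
open Summit.BirchSwinnertonDyer.BirchSwinnertonDyer.Theorems.KPort
open Summit.BirchSwinnertonDyer.BirchSwinnertonDyer.Theorems.KimAtThreeKwFrobenius
open Summit.BirchSwinnertonDyer.BirchSwinnertonDyer.Theorems.KimAtThreeAnomalousTorsion
open _root_.WeierstrassCurve Literature.NumberTheory.EllipticCurves
  Literature.NumberTheory.EllipticCurves.FormalGroupChart Literature.NumberTheory.EllipticCurves.EulerLattice

namespace Summit.BirchSwinnertonDyer.BirchSwinnertonDyer.Theorems.KimAtThreeFrobeniusFixedField

variable {p : ℕ} [hp : Fact p.Prime] {L : Type} [Field L] [NumberField L]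
  {w : ((Rat.HeightOneSpectrum.primesEquiv (R := 𝓞 ℚ)).symm ⟨p, hp.out⟩).Extension (𝓞 L)}

/-- **The elements of `L_w` fixed by `σ_w` lie in `ℚ_v` when `ord σ = [L_w : ℚ_v]`** (`σ ∈ Aut(L/ℚ)`,
`σ • w = w`).  Artin: for the subgroup `H = ⟨σ_w⟩` of `Aut(L_w/ℚ_v)`, `[L_w : L_w^H] = #H = ord σ_w`,
and `ord σ_w = ord σ` (`L ↪ L_w`); so `[L_w : L_w^H] = [L_w : ℚ_v]`, `L_w^H = ℚ_v`.
[cite: CasselsFrohlichANT1967, Ch. VII §1.1] -/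
theorem mem_range_algebraMap_of_galAdicCompletionMap_eq (σ : L ≃ₐ[ℚ] L) (hσ : σ • w.1 = w.1)
    (hord : orderOf σ = Module.finrank
      (((Rat.HeightOneSpectrum.primesEquiv (R := 𝓞 ℚ)).symm ⟨p, hp.out⟩).adicCompletion ℚ)
      (w.1.adicCompletion L))
    (z : w.1.adicCompletion L) (hz : galAdicCompletionMap σ hσ z = z) :
    z ∈ Set.range (algebraMap
      (((Rat.HeightOneSpectrum.primesEquiv (R := 𝓞 ℚ)).symm ⟨p, hp.out⟩).adicCompletion ℚ)
      (w.1.adicCompletion L)) := by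
  let v := (Rat.HeightOneSpectrum.primesEquiv (R := 𝓞 ℚ)).symm ⟨p, hp.out⟩
  let τ : (w.1.adicCompletion L) ≃ₐ[v.adicCompletion ℚ] (w.1.adicCompletion L) :=
    AlgEquiv.ofRingEquiv (f := galAdicCompletionEquiv σ hσ)
      (galAdicCompletionMap_algebraMap_adicCompletion v σ w w hσ)
  have hτ : ∀ y, τ y = galAdicCompletionMap σ hσ y := fun _ => rfl
  have hτpow : ∀ n : ℕ, ∀ y,
      (τ ^ n) y = galAdicCompletionMap (σ ^ n) (pow_smul_eq_self σ hσ n) y := by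
    intro n
    induction n with
    | zero =>
      intro y
      rw [pow_zero, AlgEquiv.one_apply,
        galAdicCompletionMap_congr_left L (pow_zero σ) _ (one_smul _ _), galAdicCompletionMap_one]
    | succ n ih =>
      intro y
      rw [pow_succ, AlgEquiv.mul_apply, ih, hτ, galAdicCompletionMap_galAdicCompletionMap,
        galAdicCompletionMap_congr_left L (pow_succ σ n).symm]
  have hordτ : orderOf τ = orderOf σ := by
    rw [orderOf_eq_orderOf_iff]
    intro n
    constructor
    · intro h
      refine AlgEquiv.ext fun x => ?_
      have hx := congrArg (fun f : (w.1.adicCompletion L) ≃ₐ[v.adicCompletion ℚ] (w.1.adicCompletion L) =>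
        f ((x : L) : w.1.adicCompletion L)) h
      simp only [hτpow, galAdicCompletionMap_coe, AlgEquiv.one_apply, AlgEquiv.smul_def] at hx
      exact (algebraMap L (w.1.adicCompletion L)).injective hx
    · intro h
      refine AlgEquiv.ext fun y => ?_
      rw [hτpow, galAdicCompletionMap_congr_left L h _ (one_smul _ _), galAdicCompletionMap_one,
        AlgEquiv.one_apply]
  -- Artin's theorem for `H = ⟨τ⟩`
  have hcard : Module.finrank (IntermediateField.fixedField (Subgroup.zpowers τ)) (w.1.adicCompletion L) =
      Module.finrank (v.adicCompletion ℚ) (w.1.adicCompletion L) := by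
    rw [IntermediateField.finrank_fixedField_eq_card, Nat.card_zpowers, hordτ, hord]
  haveI : Module.Free (v.adicCompletion ℚ) (IntermediateField.fixedField (Subgroup.zpowers τ)) :=
    Module.Free.of_divisionRing _ _
  haveI : Module.Free (IntermediateField.fixedField (Subgroup.zpowers τ)) (w.1.adicCompletion L) :=
    Module.Free.of_divisionRing _ _
  have htower := Module.finrank_mul_finrank (v.adicCompletion ℚ)
    (IntermediateField.fixedField (Subgroup.zpowers τ)) (w.1.adicCompletion L)
  rw [hcard] at htower
  have hpos : 0 < Module.finrank (v.adicCompletion ℚ) (w.1.adicCompletion L) := Module.finrank_pos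
  have h1 : Module.finrank (v.adicCompletion ℚ) (IntermediateField.fixedField (Subgroup.zpowers τ)) = 1 :=
    Nat.eq_of_mul_eq_mul_right hpos (htower.trans (one_mul _).symm)
  have hbot : IntermediateField.fixedField (Subgroup.zpowers τ) = ⊥ :=
    IntermediateField.finrank_eq_one_iff.mp h1
  have hzH : z ∈ IntermediateField.fixedField (Subgroup.zpowers τ) := by
    rw [IntermediateField.mem_fixedField_iff]
    intro f hf
    have hle : Subgroup.zpowers τ ≤ MulAction.stabilizer _ z := by
      rw [Subgroup.zpowers_le, MulAction.mem_stabilizer_iff, AlgEquiv.smul_def, hτ]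
      exact hz
    have := hle hf
    rwa [MulAction.mem_stabilizer_iff, AlgEquiv.smul_def] at this
  rw [hbot, IntermediateField.mem_bot] at hzH
  exact hzH

/-- **Unramified case**: for `e(w∣p) = 1` the hypothesis is `ord σ = f(w∣p)` (`[L_w : ℚ_v] = e·f`).
[cite: CasselsFrohlichANT1967, Ch. VII §1.1 and Ch. II §10] -/
theorem mem_range_algebraMap_of_galAdicCompletionMap_eq_of_unramified
    (he : w.1.asIdeal.ramificationIdx (𝓞 ℚ) = 1) (σ : L ≃ₐ[ℚ] L) (hσ : σ • w.1 = w.1)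
    (hord : orderOf σ = w.1.asIdeal.inertiaDeg (𝓞 ℚ))
    (z : w.1.adicCompletion L) (hz : galAdicCompletionMap σ hσ z = z) :
    z ∈ Set.range (algebraMap
      (((Rat.HeightOneSpectrum.primesEquiv (R := 𝓞 ℚ)).symm ⟨p, hp.out⟩).adicCompletion ℚ)
      (w.1.adicCompletion L)) := by
  refine mem_range_algebraMap_of_galAdicCompletionMap_eq σ hσ ?_ z hz
  have h := HeightOneSpectrum.adicCompletion.ramificationIdx_mul_inertiaDeg_eq_finrank ℚ L w
  rw [he, one_mul] at h
  rw [hord, h]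

/-- `#M[p] = 1 ⇒ M[p] = 0` (the item's spelling `Nat.card {Q // p • Q = 0} = 1` of "no `p`-torsion").
[folklore] -/
theorem forall_nsmul_eq_zero_of_natCard_eq_one {M : Type*} [AddCommGroup M] {n : ℕ}
    (h : Nat.card {Q : M // n • Q = 0} = 1) (Q : M) (hQ : n • Q = 0) : Q = 0 := by
  have hs := (Nat.card_eq_one_iff_unique.mp h).1
  exact congrArg Subtype.val (hs.elim ⟨Q, hQ⟩ ⟨0, smul_zero _⟩)

/-- Any two `ℚ`-algebra structures are compatible along `ℚ_v → L_w`. [folklore] -/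
theorem isScalarTower_rat {F K : Type*} [Field F] [Field K] [Algebra ℚ F] [Algebra ℚ K] [Algebra F K] :
    IsScalarTower ℚ F K :=
  IsScalarTower.of_algebraMap_eq' (Subsingleton.elim _ _)

variable (W : WeierstrassCurve ℚ) [W.IsElliptic] [W.IsGloballyMinimal]

/-- **`E(L_w)[p] = 0` on a good-ANOMALOUS row** (`p ≥ 3`, `p ∤ Δ_min(W)`, `a_p ≡ 1 (mod p)`, `w ∣ p`
unramified) **from `E(ℚ_v)[p] = 0` and the global Frobenius `σ`** (`σ • w = w`,
`σ • a ≡ a^p (mod 𝔭_w)` on `𝓞 L`, `ord σ = f(w∣p)`): the fixed-field hypothesis of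
`KimAtThreeAnomalousTorsion.forall_prime_nsmul_eq_zero_of_frobenius` discharged by
`mem_range_algebraMap_of_galAdicCompletionMap_eq_of_unramified`.
[cite: SilvermanAEC2009, VII.3 Prop. 3.1 and IV.6 Thm. 6.1] [cite: CasselsFrohlichANT1967, Ch. VII §1.1] -/
theorem forall_prime_nsmul_eq_zero_of_frobenius [he : Fact (w.1.asIdeal.ramificationIdx (𝓞 ℚ) = 1)]
    (hp3 : 3 ≤ p) (hΔ : ¬ (p : ℤ) ∣ minimalDiscriminantInt W) (hap : (p : ℤ) ∣ W.frobeniusTrace p - 1)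
    (σ : L ≃ₐ[ℚ] L) (hσ : σ • w.1 = w.1) (hσp : ∀ a : 𝓞 L, σ • a - a ^ p ∈ w.1.asIdeal)
    (hord : orderOf σ = w.1.asIdeal.inertiaDeg (𝓞 ℚ))
    (hF : ∀ Q : (W.baseChange (((Rat.HeightOneSpectrum.primesEquiv (R := 𝓞 ℚ)).symm ⟨p, hp.out⟩).adicCompletion ℚ)).toAffine.Point, p • Q = 0 → Q = 0)
    (P : (W.baseChange (w.1.adicCompletion L)).toAffine.Point) (hP : p • P = 0) : P = 0 := by
  haveI : IsScalarTower ℚ (((Rat.HeightOneSpectrum.primesEquiv (R := 𝓞 ℚ)).symm ⟨p, hp.out⟩).adicCompletion ℚ) (w.1.adicCompletion L) := isScalarTower_rat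
  exact KimAtThreeAnomalousTorsion.forall_prime_nsmul_eq_zero_of_frobenius W hp3 hΔ hap σ hσ hσp
    (mem_range_algebraMap_of_galAdicCompletionMap_eq_of_unramified he.out σ hσ hord) hF P hP

/-- **The lattice lemma `log_ω E(L_w) = E_p(σ_w)⁻¹𝒪_w` on a good-ANOMALOUS row, every local
hypothesis discharged from global data**: `W/ℚ` globally minimal, `p ≥ 3`, `p ∤ Δ_min(W)`,
`a_p ≡ 1 (mod p)`, `E(ℚ_v)[p] = 0`; `w ∣ p` with `e(w∣p) = 1`; `σ ∈ Aut(L/ℚ)` with `σ • w = w`,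
`σ • a ≡ a^p (mod 𝔭_w)` on `𝓞 L`, `ord σ = f(w∣p)`; `φ` the transport of `σ` to `K_w`.  Then for
`y ∈ K_w`: `(∃ P ∈ E(L_w), log_ω P = y) ↔ ‖φφy − a_p·φy + p·y‖ ≤ ‖p‖`.
[cite: BlochKato1990, Example 3.11] [cite: SilvermanAEC2009, VII.3.1, IV.6.1, IV.6.4] -/
theorem exists_padicLog_eq_iff_of_frobenius_anomalous
    [he : Fact (w.1.asIdeal.ramificationIdx (𝓞 ℚ) = 1)]
    (hp3 : 3 ≤ p) (hΔ : ¬ (p : ℤ) ∣ minimalDiscriminantInt W) (hap : (p : ℤ) ∣ W.frobeniusTrace p - 1)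
    (hF : ∀ Q : (W.baseChange (((Rat.HeightOneSpectrum.primesEquiv (R := 𝓞 ℚ)).symm ⟨p, hp.out⟩).adicCompletion ℚ)).toAffine.Point, p • Q = 0 → Q = 0)
    (σ : L ≃ₐ[ℚ] L) (hσ : σ • w.1 = w.1) (hσp : ∀ a : 𝓞 L, σ • a - a ^ p ∈ w.1.asIdeal)
    (hord : orderOf σ = w.1.asIdeal.inertiaDeg (𝓞 ℚ))
    (φ : Kw p L w →ₐ[ℚ_[p]] Kw p L w)
    (hφ : ∀ y, Kw.toCompletion p L w (φ y) = galAdicCompletionMap σ hσ (Kw.toCompletion p L w y))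
    (y : Kw p L w) :
    haveI := isIntegral_baseChange w.1 W
    (∃ P : (W.baseChange (w.1.adicCompletion L)).toAffine.Point,
      padicLogPointFiniteExt (NormedField.valuation : Valuation (w.1.adicCompletion L) ℝ≥0)
        (W.baseChange (w.1.adicCompletion L)) p P = Kw.toCompletion p L w y) ↔
    ‖φ (φ y) - (W.frobeniusTrace p : Kw p L w) * φ y + (p : Kw p L w) * y‖ ≤ ‖(p : Kw p L w)‖ :=
  exists_padicLog_eq_iff_of_frobenius W hΔ σ hσ hσp hord φ hφ
    (forall_prime_nsmul_eq_zero_of_frobenius W hp3 hΔ hap σ hσ hσp hord hF) y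

end Summit.BirchSwinnertonDyer.BirchSwinnertonDyer.Theorems.KimAtThreeFrobeniusFixedField
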